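import Literature.AlgebraicGeometry.Resolution.QuadraticTransformsUFD
import Literature.AlgebraicGeometry.Resolution.QuadraticTransforms
import Literature.AlgebraicGeometry.Resolution.QuadraticTransformWeakTransform
import HarnessLib

/-!
# Crux `FolLU` (stmt-ResolutionOfSingularities-17081), line `birth` — stub `stub_goodOfTop`

Route `ResolutionOfSingularities/FoliationDescent`, the low-dimensional engine (valuative weak
Seidenberg theorem by a colength potential). **A state of colength zero is GOOD.**

STATE: a two-dimensional regular local ring `R ⊆ K` with regular system of parameters `(x, y)`,
a derivation `D` of `K` with (VAL) `D(R) ⊆ R·Dx + R·Dy`, `(Dx, Dy) ≠ 0`, and a log pair `(A, B)`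
tied to `D` by the FREE relation `A·Dx + x·B·Dy = 0` or the CROSSING relation
`A·y·Dx + B·x·Dy = 0`. If `(A, B) = R` (in a local ring: `A` or `B` is a unit) then some `g ≠ 0`
has `gD ↷ R` NON-SINGULAR (a value is a unit of `R`) or SINGULAR (all values in `𝔪`) with
NON-NILPOTENT LINEAR PART (`gD(gD f) ∉ 𝔪²` for some `f ∈ 𝔪`) and SATURATED (no non-zero `t ∈ 𝔪`
divides all values).

Proof. Two normal forms for the rescaled derivation, `g` being DEFINED by prescribing
`(gDx, gDy)` proportional to `(Dx, Dy)`: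
* `good_of_unit_rel` — a relation `U·Dx + V·Dy = 0` with `U` a unit: `g := U / Dy` gives
  `(gDx, gDy) = (−V, U)`, so `gD(R) ⊆ R` by (VAL) and `gDy = U` is a unit: NON-SINGULAR;
* `singular_of_normal_form` — `(gDx, gDy) = (x·u, Q)` with `u` a unit, `Q ∈ 𝔪`, `x ∤ Q`: all
  values `a·x·u + b·Q` lie in `𝔪`; `gD(gD x) = gD(x u) = x u² + x·gD(u) ≡ x u² ≢ 0 (mod 𝔪²)`
  (`x ∉ 𝔪²`, `fst_not_mem_sq`); and a non-unit `t` dividing `gDx = x u` is an associate of the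
  prime `x`, so cannot divide `gDy = Q`: SATURATED.
Cases (`free_case`, `crossing_case_of_isUnit`, assembled in `stub_goodOfTop`):
FREE, `A` a unit: first form with `(U, V) = (A, xB)`. FREE, `A ∈ 𝔪` (so `B` a unit): if
`A = x A₁` then `A₁·Dx + B·Dy = 0`, first form in the coordinates `(y, x)`; if `x ∤ A` then
`g := A / Dy`, `(gDx, gDy) = (x·(−B), A)`, second form. CROSSING with `A` a unit (the case `B` a
unit is the same in the coordinates `(y, x)`): if `B = y B₁` then `A·Dx + x B₁·Dy = 0`, first
form; if `y ∤ B` then `g := yA / Dy`, `(gDy, gDx) = (y·A, −xB)` with `y ∤ xB` (`y` prime,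
`y ∤ x`), second form in the coordinates `(y, x)`.

References: J. Giraud, *Forme normale d'une fonction sur une surface de caractéristique
positive*, Bull. SMF 111 (1983), Lemma 2.8 [Giraud1983]; the notion of reduced / log-canonical
singularities of vector fields on surfaces is Seidenberg's (Amer. J. Math. 90 (1968)).
-/

set_option linter.dupNamespace false -- mandated namespace of this single-conjunct summit

noncomputable section

namespace Summit.ResolutionOfSingularities.ResolutionOfSingularities.Theorems.FolLU

namespace GoodOfTop

open Literature.AlgebraicGeometry.Resolution IsLocalRing

variable {K : Type} [Field K] (D : Derivation ℤ K K) {R : Subring K}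

/-! ## Generalities: values of a rescaled derivation -/

/-- (VAL) is symmetric in the two parameters. [folklore] -/
theorem val_symm {x y : R}
    (hval : ∀ f : R, ∃ a b : R, D (f : K) = (a : K) * D (x : K) + (b : K) * D (y : K)) :
    ∀ f : R, ∃ a b : R, D (f : K) = (a : K) * D (y : K) + (b : K) * D (x : K) := by
  intro f
  obtain ⟨a, b, h⟩ := hval f
  exact ⟨b, a, by rw [h]; ring⟩

/-- If `(gDx, gDy) = (P, Q) ∈ R²` then by (VAL) every value `gD f`, `f ∈ R`, is `a P + b Q ∈ R`.
[folklore] -/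
theorem exists_val_eq {x y : R}
    (hval : ∀ f : R, ∃ a b : R, D (f : K) = (a : K) * D (x : K) + (b : K) * D (y : K))
    {g : K} {P Q : R} (hP : g * D (x : K) = P) (hQ : g * D (y : K) = Q) (f : R) :
    ∃ a b : R, g * D (f : K) = ((a * P + b * Q : R) : K) := by
  obtain ⟨a, b, h⟩ := hval f
  refine ⟨a, b, ?_⟩
  rw [h, Subring.coe_add, Subring.coe_mul, Subring.coe_mul, ← hP, ← hQ]
  ring

/-- If `(gDx, gDy) ∈ R²` then `gD(R) ⊆ R`. [folklore] -/
theorem val_mem {x y : R}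
    (hval : ∀ f : R, ∃ a b : R, D (f : K) = (a : K) * D (x : K) + (b : K) * D (y : K))
    {g : K} {P Q : R} (hP : g * D (x : K) = P) (hQ : g * D (y : K) = Q) (f : R) :
    g * D (f : K) ∈ R := by
  obtain ⟨a, b, h⟩ := exists_val_eq D hval hP hQ f
  rw [h]
  exact SetLike.coe_mem _

/-! ## The non-singular normal form -/

/-- **Non-singular normal form.** A relation `U·Dx + V·Dy = 0` with `U` a unit of `R` makes
`g := U / Dy` a rescaling with `(gDx, gDy) = (−V, U)`: `gD ↷ R` and the value `gDy = U` is a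
unit. [cite: Giraud1983, Lemma 2.8] -/
theorem good_of_unit_rel {x y : R}
    (hval : ∀ f : R, ∃ a b : R, D (f : K) = (a : K) * D (x : K) + (b : K) * D (y : K))
    (hD : D (x : K) ≠ 0 ∨ D (y : K) ≠ 0) {U V : R}
    (hrel : (U : K) * D (x : K) + (V : K) * D (y : K) = 0) (hU : IsUnit U) :
    ∃ g : K, g ≠ 0 ∧ (∀ f : R, g * D (f : K) ∈ R) ∧
      (∃ f : R, g * D (f : K) ≠ 0 ∧ (g * D (f : K))⁻¹ ∈ R) := by
  obtain ⟨hU0, hUinv⟩ := (isUnit_subring_iff_inv_mem U).mp hU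
  have hDy : D (y : K) ≠ 0 := by
    intro hy
    rw [hy, mul_zero, add_zero] at hrel
    rcases hD with hx | hy'
    · exact hx ((mul_eq_zero.mp hrel).resolve_left hU0)
    · exact hy' hy
  refine ⟨(U : K) / D (y : K), div_ne_zero hU0 hDy, ?_, ?_⟩
  · have hQ : (U : K) / D (y : K) * D (y : K) = U := div_mul_cancel₀ _ hDy
    have hP : (U : K) / D (y : K) * D (x : K) = ((-V : R) : K) := by
      rw [Subring.coe_neg, div_mul_eq_mul_div, div_eq_iff hDy]
      linear_combination hrel
    exact val_mem D hval hP hQ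
  · refine ⟨y, ?_, ?_⟩ <;> rw [div_mul_cancel₀ _ hDy]
    exacts [hU0, hUinv]

/-! ## Regular systems of parameters of a two-dimensional regular local ring -/

section Rsop

variable [IsRegularLocalRing R] {x y : R}

/-- `x ∈ 𝔪` for `𝔪 = (x, y)`. [folklore] -/
theorem fst_mem (hm : maximalIdeal R = Ideal.span {x, y}) : x ∈ maximalIdeal R :=
  hm ▸ Ideal.subset_span (by simp)

/-- `𝔪 = (x, y) = (y, x)`. [folklore] -/
theorem span_pair_symm (hm : maximalIdeal R = Ideal.span {x, y}) :
    maximalIdeal R = Ideal.span {y, x} := by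
  rw [hm, Set.pair_comm]

/-- `x ≠ 0` for a regular system of parameters `(x, y)` (as `x ∉ 𝔪²`). [folklore] -/
theorem fst_ne_zero (hdim : ringKrullDim R = 2) (hm : maximalIdeal R = Ideal.span {x, y}) :
    x ≠ 0 := by
  rintro rfl
  exact fst_not_mem_sq hdim hm (Ideal.zero_mem _)

/-- `x` is a prime element for a regular system of parameters `(x, y)`. [cite: Matsumura1987, Thm. 14.3] -/
theorem fst_prime (hdim : ringKrullDim R = 2) (hm : maximalIdeal R = Ideal.span {x, y}) :
    Prime x :=
  IsRegularLocalRing.prime_of_not_mem_sq (fst_mem hm) (fst_not_mem_sq hdim hm)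

/-- `x ∤ y` for a regular system of parameters `(x, y)` (else `𝔪 = (x)` would be principal).
[folklore] -/
theorem fst_not_dvd_snd (hdim : ringKrullDim R = 2) (hm : maximalIdeal R = Ideal.span {x, y}) :
    ¬ x ∣ y := by
  intro hdvd
  apply maximalIdeal_ne_span_singleton hdim x
  rw [hm]
  apply le_antisymm
  · rw [Ideal.span_le]
    rintro _ (rfl | rfl)
    · exact Ideal.mem_span_singleton_self _
    · exact Ideal.mem_span_singleton.mpr hdvd
  · exact Ideal.span_mono (Set.singleton_subset_iff.mpr (Set.mem_insert _ _))

/-- A non-unit divisor `t` of `x` is divisible by `x` (`x` is irreducible). [folklore] -/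
theorem fst_dvd_of_dvd (hdim : ringKrullDim R = 2) (hm : maximalIdeal R = Ideal.span {x, y})
    {t : R} (ht : t ∈ maximalIdeal R) (htx : t ∣ x) : x ∣ t := by
  rcases (fst_prime hdim hm).irreducible.dvd_iff.mp htx with h | h
  · exact absurd h ht
  · exact h.dvd

/-- `x · v ∉ 𝔪²` for a unit `v` (as `x ∉ 𝔪²`). [folklore] -/
theorem fst_mul_unit_not_mem_sq (hdim : ringKrullDim R = 2)
    (hm : maximalIdeal R = Ideal.span {x, y}) {v : R} (hv : IsUnit v) :
    x * v ∉ maximalIdeal R ^ 2 := by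
  intro h
  obtain ⟨w, hw⟩ := hv.exists_right_inv
  apply fst_not_mem_sq hdim hm
  have e : x = x * v * w := by rw [mul_assoc, hw, mul_one]
  rw [e]
  exact Ideal.mul_mem_right _ _ h

/-- In a local ring, `(A, B) = R` forces `A` or `B` to be a unit. [folklore] -/
theorem isUnit_or_isUnit_of_span_pair_eq_top {A B : R} (htop : Ideal.span {A, B} = ⊤) :
    IsUnit A ∨ IsUnit B := by
  by_contra h
  push Not at h
  apply (maximalIdeal.isMaximal R).ne_top
  rw [eq_top_iff, ← htop, Ideal.span_le]
  rintro _ (rfl | rfl)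
  · exact (mem_maximalIdeal _).mpr (mem_nonunits_iff.mpr h.1)
  · exact (mem_maximalIdeal _).mpr (mem_nonunits_iff.mpr h.2)

end Rsop

/-! ## The singular normal form -/

section Singular

variable [IsRegularLocalRing R] {x y : R}

/-- **Singular normal form.** If `g ≠ 0` has `(gDx, gDy) = (x·u, Q)` with `u` a unit, `Q ∈ 𝔪`
and `x ∤ Q`, then `gD ↷ R` is singular (values `a x u + b Q ∈ 𝔪`), has non-nilpotent linear part
(`gD(gD x) = x u² + x·gD(u) ∉ 𝔪²`) and is saturated (a common non-unit divisor `t` of the values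
divides `x u`, so is an associate of the prime `x`, and divides `Q`). [cite: Giraud1983, Lemma 2.8] -/
theorem singular_of_normal_form (hdim : ringKrullDim R = 2)
    (hm : maximalIdeal R = Ideal.span {x, y})
    (hval : ∀ f : R, ∃ a b : R, D (f : K) = (a : K) * D (x : K) + (b : K) * D (y : K))
    {g : K} {u Q : R} (hu : IsUnit u) (hQm : Q ∈ maximalIdeal R) (hxQ : ¬ x ∣ Q)
    (hP : g * D (x : K) = ((x * u : R) : K)) (hQ : g * D (y : K) = Q) :
    (∀ f : R, ∃ w : R, w ∈ maximalIdeal R ∧ (w : K) = g * D (f : K)) ∧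
      (∃ f : R, f ∈ maximalIdeal R ∧
        ∀ w : R, (w : K) = g * D (g * D (f : K)) → w ∉ maximalIdeal R ^ 2) ∧
      (∀ t : R, t ∈ maximalIdeal R → t ≠ 0 →
        ∃ f : R, ∀ w : R, (w : K) = g * D (f : K) → ¬ t ∣ w) := by
  have hxm : x ∈ maximalIdeal R := fst_mem hm
  have hPm : x * u ∈ maximalIdeal R := Ideal.mul_mem_right _ _ hxm
  -- singular: every value lies in `𝔪`
  have hsing : ∀ f : R, ∃ w : R, w ∈ maximalIdeal R ∧ (w : K) = g * D (f : K) := by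
    intro f
    obtain ⟨a, b, h⟩ := exists_val_eq D hval hP hQ f
    exact ⟨a * (x * u) + b * Q,
      Ideal.add_mem _ (Ideal.mul_mem_left _ _ hPm) (Ideal.mul_mem_left _ _ hQm), h.symm⟩
  refine ⟨hsing, ⟨x, hxm, ?_⟩, ?_⟩
  · -- non-nilpotent linear part: `gD(gD x) = x u² + x·gD(u) ∉ 𝔪²`
    intro w hw hw2
    obtain ⟨wu, hwum, hwu⟩ := hsing u
    have hP' : g * D (x : K) = (x : K) * (u : K) := by rw [hP, Subring.coe_mul]
    have e : (w : K) = ((x * wu + x * u * u : R) : K) := by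
      rw [hw, hP, Subring.coe_mul, Derivation.leibniz, smul_eq_mul, smul_eq_mul,
        Subring.coe_add, Subring.coe_mul, Subring.coe_mul, Subring.coe_mul, hwu]
      linear_combination (u : K) * hP'
    have e' : w = x * wu + x * u * u := Subtype.ext e
    rw [e'] at hw2
    have h1 : x * wu ∈ maximalIdeal R ^ 2 := by
      rw [pow_two]
      exact Ideal.mul_mem_mul hxm hwum
    have h2 : x * u * u ∈ maximalIdeal R ^ 2 := by
      have := Ideal.sub_mem _ hw2 h1
      rwa [add_sub_cancel_left] at this
    rw [mul_assoc] at h2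
    exact fst_mul_unit_not_mem_sq hdim hm (hu.mul hu) h2
  · -- saturated
    intro t ht _ht0
    by_contra h
    push Not at h
    obtain ⟨w₁, hw₁, htw₁⟩ := h x
    obtain ⟨w₂, hw₂, htw₂⟩ := h y
    rw [hP] at hw₁
    rw [hQ] at hw₂
    have e₁ : w₁ = x * u := Subtype.ext hw₁
    have e₂ : w₂ = Q := Subtype.ext hw₂
    rw [e₁, hu.dvd_mul_right] at htw₁
    rw [e₂] at htw₂
    exact hxQ ((fst_dvd_of_dvd hdim hm ht htw₁).trans htw₂)

end Singular

/-! ## The cases -/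

section Cases

variable [IsRegularLocalRing R]

/-- **FREE case**: `A·Dx + x·B·Dy = 0` with `A` or `B` a unit ⇒ GOOD. [cite: Giraud1983, Lemma 2.8] -/
theorem free_case (hdim : ringKrullDim R = 2) {x y A B : R}
    (hm : maximalIdeal R = Ideal.span {x, y})
    (hval : ∀ f : R, ∃ a b : R, D (f : K) = (a : K) * D (x : K) + (b : K) * D (y : K))
    (hD : D (x : K) ≠ 0 ∨ D (y : K) ≠ 0)
    (hrel : (A : K) * D (x : K) + (x : K) * (B : K) * D (y : K) = 0)
    (hAB : IsUnit A ∨ IsUnit B) :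
    ∃ g : K, g ≠ 0 ∧ (∀ f : R, g * D (f : K) ∈ R) ∧
      ((∃ f : R, g * D (f : K) ≠ 0 ∧ (g * D (f : K))⁻¹ ∈ R) ∨
        ((∀ f : R, ∃ w : R, w ∈ maximalIdeal R ∧ (w : K) = g * D (f : K)) ∧
          (∃ f : R, f ∈ maximalIdeal R ∧
            ∀ w : R, (w : K) = g * D (g * D (f : K)) → w ∉ maximalIdeal R ^ 2) ∧
          (∀ t : R, t ∈ maximalIdeal R → t ≠ 0 →
            ∃ f : R, ∀ w : R, (w : K) = g * D (f : K) → ¬ t ∣ w))) := by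
  by_cases hA : IsUnit A
  · -- `(U, V) = (A, x B)`
    have hrel' : (A : K) * D (x : K) + ((x * B : R) : K) * D (y : K) = 0 := by
      rw [Subring.coe_mul]
      linear_combination hrel
    obtain ⟨g, hg0, hgR, hns⟩ := good_of_unit_rel D hval hD hrel' hA
    exact ⟨g, hg0, hgR, Or.inl hns⟩
  have hB : IsUnit B := hAB.resolve_left hA
  have hx0 : x ≠ 0 := fst_ne_zero hdim hm
  have hx0K : (x : K) ≠ 0 := fun e => hx0 (Subtype.ext (by simpa using e))
  by_cases hxA : x ∣ A
  · -- `A = x A₁`, `A₁·Dx + B·Dy = 0`: non-singular form in the coordinates `(y, x)`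
    obtain ⟨A₁, rfl⟩ := hxA
    have hrel' : (B : K) * D (y : K) + (A₁ : K) * D (x : K) = 0 := by
      rw [Subring.coe_mul] at hrel
      have e : (x : K) * ((B : K) * D (y : K) + (A₁ : K) * D (x : K)) = 0 := by
        linear_combination hrel
      exact (mul_eq_zero.mp e).resolve_left hx0K
    obtain ⟨g, hg0, hgR, hns⟩ := good_of_unit_rel D (val_symm D hval) hD.symm hrel' hB
    exact ⟨g, hg0, hgR, Or.inl hns⟩
  · -- `x ∤ A`: `g := A / Dy`, `(gDx, gDy) = (x (−B), A)`: singular form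
    have hA0 : A ≠ 0 := by
      rintro rfl
      exact hxA (dvd_zero x)
    have hA0K : (A : K) ≠ 0 := fun e => hA0 (Subtype.ext (by simpa using e))
    have hDy : D (y : K) ≠ 0 := by
      intro hy
      rw [hy, mul_zero, add_zero] at hrel
      rcases hD with hx | hy'
      · exact hx ((mul_eq_zero.mp hrel).resolve_left hA0K)
      · exact hy' hy
    have hAm : A ∈ maximalIdeal R := (mem_maximalIdeal _).mpr (mem_nonunits_iff.mpr hA)
    have hQ : (A : K) / D (y : K) * D (y : K) = A := div_mul_cancel₀ _ hDy
    have hP : (A : K) / D (y : K) * D (x : K) = ((x * -B : R) : K) := by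
      rw [Subring.coe_mul, Subring.coe_neg, div_mul_eq_mul_div, div_eq_iff hDy]
      linear_combination hrel
    obtain ⟨h1, h2, h3⟩ := singular_of_normal_form D hdim hm hval hB.neg hAm hxA hP hQ
    exact ⟨(A : K) / D (y : K), div_ne_zero hA0K hDy, val_mem D hval hP hQ, Or.inr ⟨h1, h2, h3⟩⟩

/-- **CROSSING case with `A` a unit**: `A·y·Dx + B·x·Dy = 0` ⇒ GOOD. [cite: Giraud1983, Lemma 2.8] -/
theorem crossing_case_of_isUnit (hdim : ringKrullDim R = 2) {x y A B : R}
    (hm : maximalIdeal R = Ideal.span {x, y})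
    (hval : ∀ f : R, ∃ a b : R, D (f : K) = (a : K) * D (x : K) + (b : K) * D (y : K))
    (hD : D (x : K) ≠ 0 ∨ D (y : K) ≠ 0)
    (hrel : (A : K) * (y : K) * D (x : K) + (B : K) * (x : K) * D (y : K) = 0)
    (hA : IsUnit A) :
    ∃ g : K, g ≠ 0 ∧ (∀ f : R, g * D (f : K) ∈ R) ∧
      ((∃ f : R, g * D (f : K) ≠ 0 ∧ (g * D (f : K))⁻¹ ∈ R) ∨
        ((∀ f : R, ∃ w : R, w ∈ maximalIdeal R ∧ (w : K) = g * D (f : K)) ∧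
          (∃ f : R, f ∈ maximalIdeal R ∧
            ∀ w : R, (w : K) = g * D (g * D (f : K)) → w ∉ maximalIdeal R ^ 2) ∧
          (∀ t : R, t ∈ maximalIdeal R → t ≠ 0 →
            ∃ f : R, ∀ w : R, (w : K) = g * D (f : K) → ¬ t ∣ w))) := by
  have hm' : maximalIdeal R = Ideal.span {y, x} := span_pair_symm hm
  have hy0 : y ≠ 0 := fst_ne_zero hdim hm'
  have hy0K : (y : K) ≠ 0 := fun e => hy0 (Subtype.ext (by simpa using e))
  by_cases hyB : y ∣ B
  · -- `B = y B₁`, `A·Dx + x B₁·Dy = 0`: non-singular form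
    obtain ⟨B₁, rfl⟩ := hyB
    have hrel' : (A : K) * D (x : K) + ((x * B₁ : R) : K) * D (y : K) = 0 := by
      rw [Subring.coe_mul] at hrel
      rw [Subring.coe_mul]
      have e : (y : K) * ((A : K) * D (x : K) + (x : K) * (B₁ : K) * D (y : K)) = 0 := by
        linear_combination hrel
      exact (mul_eq_zero.mp e).resolve_left hy0K
    obtain ⟨g, hg0, hgR, hns⟩ := good_of_unit_rel D hval hD hrel' hA
    exact ⟨g, hg0, hgR, Or.inl hns⟩
  · -- `y ∤ B`: `g := y A / Dy`, `(gDy, gDx) = (y A, −x B)`: singular form in `(y, x)`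
    obtain ⟨hA0K, -⟩ := (isUnit_subring_iff_inv_mem A).mp hA
    have hDy : D (y : K) ≠ 0 := by
      intro hy
      rw [hy, mul_zero, add_zero] at hrel
      rcases hD with hx | hy'
      · exact hx ((mul_eq_zero.mp hrel).resolve_left (mul_ne_zero hA0K hy0K))
      · exact hy' hy
    have hxm : x ∈ maximalIdeal R := fst_mem hm
    have hQm : -(x * B) ∈ maximalIdeal R := Submodule.neg_mem _ (Ideal.mul_mem_right _ _ hxm)
    have hyQ : ¬ y ∣ -(x * B) := by
      rw [dvd_neg]
      intro h
      rcases (fst_prime hdim hm').dvd_or_dvd h with h' | h'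
      · exact fst_not_dvd_snd hdim hm' h'
      · exact hyB h'
    have hP : (y : K) * (A : K) / D (y : K) * D (y : K) = ((y * A : R) : K) := by
      rw [div_mul_cancel₀ _ hDy, Subring.coe_mul]
    have hQ : (y : K) * (A : K) / D (y : K) * D (x : K) = ((-(x * B) : R) : K) := by
      rw [Subring.coe_neg, Subring.coe_mul, div_mul_eq_mul_div, div_eq_iff hDy]
      linear_combination hrel
    obtain ⟨h1, h2, h3⟩ :=
      singular_of_normal_form D hdim hm' (val_symm D hval) hA hQm hyQ hP hQ
    exact ⟨(y : K) * (A : K) / D (y : K), div_ne_zero (mul_ne_zero hy0K hA0K) hDy,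
      val_mem D (val_symm D hval) hP hQ, Or.inr ⟨h1, h2, h3⟩⟩

end Cases

end GoodOfTop

open Literature.AlgebraicGeometry.Resolution IsLocalRing

/-- **A state of colength zero is GOOD.** If the log pair `(A, B)` of the derivation `D` at the
two-dimensional regular local ring `R` (FREE relation `A·Dx + x·B·Dy = 0` or CROSSING relation
`A·y·Dx + B·x·Dy = 0`, (VAL) `D(R) ⊆ R·Dx + R·Dy`, `(Dx, Dy) ≠ 0`) generates the unit ideal, then
some `g ≠ 0` has `gD ↷ R` non-singular, or singular, saturated and with non-nilpotent linear
part. FREE: `(Dx, Dy) ∝ (−xB, A)`; `A` a unit ⇒ `(gDx, gDy) = (−xB, A)` is non-singular; `A ∈ 𝔪`,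
`B` a unit: `x ∤ A` ⇒ the same `g` is singular, saturated, with `gD(x) ≡ −B x (mod 𝔪²)`;
`A = x A₁` ⇒ `(gDx, gDy) = (−B, A₁)`, non-singular. CROSSING: `(Dx, Dy) ∝ (−xB, yA)`; `A` a unit:
`y ∤ B` ⇒ `(gDx, gDy) = (−xB, yA)`, singular, saturated, `gD(y) ≡ A y (mod 𝔪²)`; `B = y B₁` ⇒
`(−xB₁, A)`, non-singular; symmetrically for `B` a unit. [cite: Giraud1983, Lemma 2.8] -/
theorem stub_goodOfTop :
    ∀ (K : Type) [Field K] (D : Derivation ℤ K K) (R : Subring K) [IsRegularLocalRing R],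
    ringKrullDim R = 2 → ∀ (x y A B : R), maximalIdeal R = Ideal.span {x, y} →
    (∀ f : R, ∃ a b : R, D (f : K) = (a : K) * D (x : K) + (b : K) * D (y : K)) →
    (D (x : K) ≠ 0 ∨ D (y : K) ≠ 0) →
    ((A : K) * D (x : K) + (x : K) * (B : K) * D (y : K) = 0 ∨
      (A : K) * (y : K) * D (x : K) + (B : K) * (x : K) * D (y : K) = 0) →
    Ideal.span {A, B} = ⊤ →
    ∃ g : K, g ≠ 0 ∧ (∀ f : R, g * D (f : K) ∈ R) ∧
      ((∃ f : R, g * D (f : K) ≠ 0 ∧ (g * D (f : K))⁻¹ ∈ R) ∨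
        ((∀ f : R, ∃ w : R, w ∈ maximalIdeal R ∧ (w : K) = g * D (f : K)) ∧
          (∃ f : R, f ∈ maximalIdeal R ∧
            ∀ w : R, (w : K) = g * D (g * D (f : K)) → w ∉ maximalIdeal R ^ 2) ∧
          (∀ t : R, t ∈ maximalIdeal R → t ≠ 0 →
            ∃ f : R, ∀ w : R, (w : K) = g * D (f : K) → ¬ t ∣ w))) := by
  intro K _ D R _ hdim x y A B hm hval hD hrel htop
  have hAB : IsUnit A ∨ IsUnit B := GoodOfTop.isUnit_or_isUnit_of_span_pair_eq_top htop
  rcases hrel with hfree | hcross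
  · exact GoodOfTop.free_case D hdim hm hval hD hfree hAB
  · rcases hAB with hA | hB
    · exact GoodOfTop.crossing_case_of_isUnit D hdim hm hval hD hcross hA
    · -- `B` a unit: the same in the coordinates `(y, x)`
      have hcross' : (B : K) * (x : K) * D (y : K) + (A : K) * (y : K) * D (x : K) = 0 := by
        linear_combination hcross
      exact GoodOfTop.crossing_case_of_isUnit D hdim (GoodOfTop.span_pair_symm hm)
        (GoodOfTop.val_symm D hval) hD.symm hcross' hB

end Summit.ResolutionOfSingularities.ResolutionOfSingularities.Theorems.FolLU
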